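import Summits.FinalStateConjecture.FinalStateConjecture.Theses.ClusterCompleteness

/-!
# Crux `LinearToNonlinearCapture` (stmt-FinalStateConjecture-14526), line `Sketch` — the scri
# split, far-exterior half: the reshape-4 stub S5 from far-exterior null completeness (S5a)

Registered sub-goal `exteriorComplete_pos_of_exteriorCompleteness` of the skeleton
`Lines/Sketch.lean` (reshape 5, lead prover `prover-line-stmt-FinalStateConjecture-14526-c2-0`,
2026-08-16; plumbing found by the wave-1 worker on S5). Complete future null infinity in
Christodoulou's sojourn form splits, by pure logic, into a statement about rays that never enter
the domain of influence `J⁺(ι Bₑ)` of a compact piece (they must be future complete) and one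
about rays that do. This file certifies that the former — stated, as the crux needs it, for
maximal developments of admissible data satisfying the hypothesis of `RecurrentMultiKerrCapture`
with `N ≥ 1` holes and settling down — follows from FAR-EXTERIOR NULL COMPLETENESS for every
maximal vacuum Cauchy development of every admissible datum (the registered stub
`stub_exteriorCompleteness`, a Klainerman–Nicolò-type statement for the tree's admissible class),
with `k := 0`, `Bₑ := K`, `B₁ := ∅`: recurrence, settling and the scalar engine are inert here.
Pure logic over the route decls.
-/

namespace Summit.FinalStateConjecture.FinalStateConjecture.Theorems

open scoped BigOperators Topology Manifold ENNReal ContDiff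
open Filter Set Function TopologicalSpace Bundle MeasureTheory
open Literature.Geometry.Lorentzian
open Summit.FinalStateConjecture.FinalStateConjecture.Theses.ClusterCompleteness

set_option linter.dupNamespace false in
/-- **Far-exterior completeness closes the far-exterior half of the scri split.** If every maximal
vacuum Cauchy development of every admissible datum has a compact `K ⊆ X` outside whose domain
of influence `J⁺(ι K)` all normalised future null rays from the data are future complete, then
for every order (here `k := 0`) every such development satisfying the hypothesis of
`RecurrentMultiKerrCapture` with `N = n + 1` holes and settling down has compact `Bₑ := K`,
`B₁ := ∅` such that every normalised null ray from outside `B₁` avoiding `J⁺(ι Bₑ)` is future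
complete (the reshape-4 stub `stub_exteriorComplete_pos` of line `Sketch`, without its inert
engine hypothesis). -/
theorem exteriorComplete_pos_of_exteriorCompleteness
    (hK : ∀ (X : Type) [TopologicalSpace X] [ChartedSpace E3 X] [IsManifold (𝓡 3) ∞ X]
          [T2Space X] [SecondCountableTopology X] [ConnectedSpace X],
          ∀ D ∈ admissibleVacuumData X, ∀ 𝒟 : VacuumCauchyDevelopment D, 𝒟.IsMaximal →
          ∀ [𝒟.metric.HasLeviCivita], ∃ K : Set X, IsCompact K ∧
            ∀ (p : X) (γ : ℝ → 𝒟.carrier) (dom : Set ℝ),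
              𝒟.metric.IsNormalisedNullRayFrom 𝒟.timeOrientation 𝒟.embed 𝒟.normal p γ dom →
              (∀ t ∈ dom, 0 ≤ t →
                γ t ∉ 𝒟.metric.causalFuture 𝒟.timeOrientation (𝒟.embed '' K)) →
              ¬ BddAbove dom) :
    ∃ k : ℕ, ∀ (X : Type) [TopologicalSpace X] [ChartedSpace E3 X] [IsManifold (𝓡 3) ∞ X]
      [T2Space X] [SecondCountableTopology X] [ConnectedSpace X],
      ∀ D ∈ admissibleVacuumData X, ∀ 𝒟 : VacuumCauchyDevelopment D, 𝒟.IsMaximal →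
      ∀ n : ℕ, (∃ (O : Set 𝒟.carrier) (M a : Fin (n + 1) → ℝ) (mo : Fin (n + 1) → lorentzGroup × E4) (τ₀ : ℝ)
        (Ψ : ∀ i, boostedKerrExterior (mo i).1 (mo i).2 (M i) (a i) → 𝒟.carrier)
        (ρ R : Fin (n + 1) → ℝ → ℝ) (U₀ : Opens E4) (Ψ₀ : U₀ → 𝒟.carrier),
        (∀ i, Kerr.IsSubextremal (M i) (a i)) ∧
        (∀ i, 𝒟.toSpacetime.IsLateChart
          (boostedKerrBackground (mo i).1 (mo i).2 (M i) (a i)) O τ₀ (Ψ i)) ∧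
        𝒟.toSpacetime.IsLateChart (Minkowski.backgroundOn U₀) O τ₀ Ψ₀ ∧
        (∀ i, Tendsto (fun t ↦ ρ i t / t) atTop (𝓝 0)) ∧
        (∀ i, Tendsto (R i) atTop atTop) ∧
        {x : E4 | τ₀ < x 0 ∧
          ∀ i, ρ i (x 0) < Kerr.radius (a i) (poincareInv (mo i).1 (mo i).2 x)} ⊆ (U₀ : Set E4) ∧
        (∀ R' : ℝ, ∃ τ₁ : ℝ, Pairwise (Function.onFun Disjoint fun i ↦
          Ψ i '' (boostedKerrBackground (mo i).1 (mo i).2 (M i) (a i)).truncLateRegion τ₁ R')) ∧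
        O = Summit.FinalStateConjecture.exteriorOf 𝒟.toCauchyDevelopment
          ((⋃ i, Ψ i '' (boostedKerrBackground (mo i).1 (mo i).2 (M i) (a i)).lateRegion τ₀) ∪
            Ψ₀ '' (Minkowski.backgroundOn U₀).lateRegion τ₀) ∧
        (∀ τ₁ : ℝ, τ₀ < τ₁ →
          O \ (Ψ₀ '' (Minkowski.backgroundOn U₀).lateRegion τ₁ ∪
            ⋃ i, Ψ i '' {x | τ₁ < (boostedKerrBackground (mo i).1 (mo i).2 (M i) (a i)).time x.1 ∧
              (boostedKerrBackground (mo i).1 (mo i).2 (M i) (a i)).radius x.1 ≤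
                R i ((boostedKerrBackground (mo i).1 (mo i).2 (M i) (a i)).time x.1)}) ⊆
          𝒟.metric.causalPast 𝒟.timeOrientation
            (Ψ₀ '' (Minkowski.backgroundOn U₀).timeSlab τ₁ ∪
              ⋃ i, Ψ i '' (boostedKerrBackground (mo i).1 (mo i).2 (M i) (a i)).truncTimeSlab
                (R i τ₁) τ₁)) ∧
        (∀ τ : ℝ, τ₀ < τ →
          𝒟.toSpacetime.deviationCk (Minkowski.backgroundOn U₀) Ψ₀ 0 τ ≤ ENNReal.ofReal (1 / 4) ∧
            ∀ i, 𝒟.toSpacetime.truncDeviationCk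
              (boostedKerrBackground (mo i).1 (mo i).2 (M i) (a i)) (Ψ i) 0 (R i τ) τ ≤
                ENNReal.ofReal (1 / 4)) ∧
        ∀ R' : ℝ, ∀ ε : ℝ, 0 < ε → ∃ᶠ τ in atTop,
          𝒟.toSpacetime.deviationCk (Minkowski.backgroundOn U₀) Ψ₀ k τ ≤ ENNReal.ofReal ε ∧
            ∀ i, 𝒟.toSpacetime.truncDeviationCk
              (boostedKerrBackground (mo i).1 (mo i).2 (M i) (a i)) (Ψ i) k R' τ ≤
                ENNReal.ofReal ε) →
      (∃ (O' : Set 𝒟.carrier) (d : FinalStateDecomposition 𝒟.toSpacetime O' 2),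
        (∀ i, Kerr.IsSubextremal (d.mass i) (d.spin i)) ∧
          O' = Summit.FinalStateConjecture.exteriorOf 𝒟.toCauchyDevelopment d.charted ∧
            Summit.FinalStateConjecture.HasExhaustiveCharts d) →
      ∀ [𝒟.metric.HasLeviCivita], ∃ Bₑ : Set X, IsCompact Bₑ ∧ ∃ B₁ : Set X, IsCompact B₁ ∧
        ∀ p ∉ B₁, ∀ (γ : ℝ → 𝒟.carrier) (dom : Set ℝ),
          𝒟.metric.IsNormalisedNullRayFrom 𝒟.timeOrientation 𝒟.embed 𝒟.normal p γ dom →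
          (∀ t ∈ dom, 0 ≤ t →
            γ t ∉ 𝒟.metric.causalFuture 𝒟.timeOrientation (𝒟.embed '' Bₑ)) →
          ¬ BddAbove dom := by
  refine ⟨0, ?_⟩
  intro X _ _ _ _ _ _ D hD 𝒟 hmax n _ _ _
  obtain ⟨K, hK', h⟩ := hK X D hD 𝒟 hmax
  exact ⟨K, hK', ∅, isCompact_empty, fun p _ γ dom hγ havoid ↦ h p γ dom hγ havoid⟩

end Summit.FinalStateConjecture.FinalStateConjecture.Theorems
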